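import Literature.MathematicalPhysics.QuantumFieldTheory.BalabanImbrieJaffe1984to88.BIJ88OpDecay230Proof

/-!
# `BalabanImbrieJaffe1984to88.BIJ88Ineq217Mechanism` — T. Bałaban, J. Imbrie, A. Jaffe, *Effective action and cluster properties of
the abelian Higgs model*, Commun. Math. Phys. **114** (1988) 257–315 [BalabanImbrieJaffe1988]: the ARGUMENT of p. 262 for **(2.17)** —
the near/far decomposition `f^{(k)} = ∂□A + f′`, the distant part by the threshold decay (2.16), the near part by the boundedness of `σ_k`
on curls — PROVED as kernel algebra over r18's `applyK` / `supNorm` / `DecayFar`, with the constant EXPLICIT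

statement-level skeleton of published theorems with citation tags; proofs where landed; nothing here is a claim about the Yang–Mills mass gap

PDF held: `paper:balaban1988-cmp114-bij-abelian-higgs-effective-action` (journal page = PDF page + 256); p. 262 [PDF 6] read this session as an
image rendered from the held PDF (seat folder `renders/bij88-p006.png`, poppler ×2.4) and from the text layer (`lit read … --pages 5-7`).

WHAT IS REPRODUCED.  SKELETON row **C2.Eq2.17** (cell `lit-balaban`, HOME `run/shared/lean/pub/lit-balaban/`; Phase-2 seat p08 gen 6 = unit
`lit-balaban-p08`, own-lane free target (G.5-34(d)) after the seat's rows C2.Eq2.13/2.23 (`BIJ88MultiscaleDecay223`, `BIJ88HolderDecay213`);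
C2 §§1–4 fold owner r18, referee ref-5; TAKING line HOME/STATUS.md 2026-08-21T06:46:30Z).  Before this file the row was r18's one-letter shape
`BIJ88Sect2Statements.Ineq217` (typed p239939) plus p02's inheritance to `σ_{k,loc}` (`BIJ88Close218Proof.ineq217_trunc`, p248140); the printed
ARGUMENT («as follows …») was untyped.
p. 262 [PDF 6], verbatim: *"we shall only encounter situations where f^{(k)}(p₂) = (∂A)(p₂) for p₂ near p₁. Then we prove that
(σ_kf^{(k)})(p₁) ≦ ‖f^{(k)}‖_∞ (2.17) as follows. Write f^{(k)} = ∂□A + f′, where □ is the characteristic function of a neighborhood of p₂. The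
distant part (σ_kf′)(p₁) is easily estimated by ‖f^{(k)}‖_∞ by (2.16). The near part is similarly bounded since σ_k is a bounded operator on
curls [2]. It was also shown in [2] that σ_k is bounded from below."*  ((2.16), p. 261: *"|σ_k(p₁,p₂)| ≦ ce^{−c dist(p₁,p₂)} for dist(p₁,p₂) ≧ c.
(2.16) … For close p₁, p₂ the kernel of σ_k can be large, of the order of η^{−2}."*)

WHAT IS PROVED HERE (0 `sorry`, standard axioms; theorems only, kind «hence-step»; r18's abstract real kernels on a finite plaquette set `α`).
The three inputs of the printed argument are DISPLAYED HYPOTHESES: (2.16) at the output plaquette `p₁` as threshold decay beyond `r₀` with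
rate `δ` and the row sum `Σ_{p₂} e^{−δ dist(p₁,p₂)} ≤ S` (`h216`, `hS`; r18's `DecayFar dist σ c` is the case `r₀ = δ = c`); «σ_k is a bounded
operator on curls [2]» for an abstract class `V` of «curls», in the sup-norm reading `|(σg)(p)| ≤ M‖g‖_∞` (`hV`) AND in the `ℓ²` reading
`‖σg‖₂ ≤ M‖g‖₂` (`hV2`, §3: then `|(σg)(p₁)| ≤ M·(#suppt g)^{1/2}‖g‖_∞`); and the near part `g = ∂□A ∈ V` agreeing with `f` within `r₀` of `p₁`
and dominated by it, `‖g‖_∞ ≤ K‖f‖_∞` (`hagree`, `hgK` — the domination is the gauge choice the printed sentence leaves implicit: `□A` must be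
small where `∂A` is, e.g. `A` in an axial gauge on the neighbourhood; it is CONSTRUCTED on the torus carriers in the sibling
`BIJ88Ineq217NearPart`).
§1 `applyK_add`/`applyK_sub`/`supNorm_sub_le` (linearity, `‖f − g‖_∞ ≤ ‖f‖_∞ + ‖g‖_∞`).
§2 THE DISTANT PART **`abs_applyK_far_le`**: `f′ = 0` within `r₀` of `p₁` ⟹ `|(σf′)(p₁)| ≤ c·(Σ_{p₂}e^{−δdist})·‖f′‖_∞` («easily estimated by
‖f^{(k)}‖_∞ by (2.16)»); `abs_applyK_far_le_of_decayFar` (r18's `DecayFar`).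
§3 THE NEAR PART in the `ℓ²` reading: `abs_le_sqrt_sum_sq`, `sum_sq_le_card_mul_supNorm_sq`, **`abs_applyK_near_le_l2`**
(`|(σg)(p₁)| ≤ M√(#s)‖g‖_∞` for `g` supported in `s`).
§4 THE SPLIT **`abs_applyK_split_le`**: `|(σf)(p₁)| ≤ N + cS(‖f‖_∞ + ‖g‖_∞)` from a near bound `N` and agreement within `r₀`.
§5 **(2.17) WITH ITS CONSTANT**: **`abs_ineq217`** `|(σ_kf)(p₁)| ≤ (MK + cS(1+K))‖f‖_∞` (sup reading), **`abs_ineq217_l2`**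
(`(M√n·K + cS(1+K))‖f‖_∞`, `ℓ²` reading, near part supported on `≤ n` plaquettes), and the printed one-sided `ineq217`.
§6 THE TYPED ROW: **`ineq217_typed`** — r18's `Ineq217 σ Near` (constant 1, print's display) with the side condition `Near p₁ f` := «f agrees
within r₀ of p₁ with some g ∈ V, ‖g‖_∞ ≤ K‖f‖_∞» is inhabited as soon as `MK + cS(1+K) ≤ 1`; `ineq217_typed_of_decayFar` (r18's `DecayFar`).
HONEST SCOPE.  The display (2.17) prints NO constant; this file proves it with the explicit constant `MK + cS(1+K)` and inhabits the typed
constant-1 shape only under the displayed smallness — print's `≦` carries the generic-constant convention of the paper (cf. (2.16) «≦ ce^{−c dist}»).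
NOT derived here: (2.16) for the concrete σ_k (row C2.Eq2.16; mechanism `BIJ88MultiscaleDecay223.decayFar216_typed`), the boundedness of σ_k on
curls ([2] = [BalabanImbrieJaffe1985] §7.1 / (4.2.7); rows of C1), the lower bound (row C2.Eq2.19, p02).  Nothing on d = 4 or the continuum;
NOT summit progress.
-/

namespace Literature.MathematicalPhysics.QuantumFieldTheory.BalabanImbrieJaffe1984to88.BIJ88Ineq217Mechanism

open Finset BIJ88Sect2Statements BIJ88Close235Proof BIJ88OpDecay230Proof

noncomputable section

variable {α : Type*} [Fintype α]

/-! ## §1  Linearity of `applyK` and the triangle inequality for `‖·‖_∞` -/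

/-- `σ(f + g) = σf + σg` pointwise. [cite: BalabanImbrieJaffe1988, (2.17) p.262] -/
theorem applyK_add (σ : α → α → ℝ) (f g : α → ℝ) (p : α) :
    applyK σ (fun a => f a + g a) p = applyK σ f p + applyK σ g p := by
  simp only [applyK, mul_add, sum_add_distrib]

/-- `σ(f − g) = σf − σg` pointwise. [cite: BalabanImbrieJaffe1988, (2.17) p.262] -/
theorem applyK_sub (σ : α → α → ℝ) (f g : α → ℝ) (p : α) :
    applyK σ (fun a => f a - g a) p = applyK σ f p - applyK σ g p := by
  simp only [applyK, mul_sub, sum_sub_distrib]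

/-- `‖f − g‖_∞ ≤ ‖f‖_∞ + ‖g‖_∞` (the distant part `f′ = f^{(k)} − ∂□A` is «estimated by ‖f^{(k)}‖_∞» once `∂□A` is).
[cite: BalabanImbrieJaffe1988, (2.17) p.262] -/
theorem supNorm_sub_le (f g : α → ℝ) : supNorm (fun a => f a - g a) ≤ supNorm f + supNorm g :=
  supNorm_le (add_nonneg (supNorm_nonneg f) (supNorm_nonneg g)) fun a =>
    (abs_sub (f a) (g a)).trans (add_le_add (abs_le_supNorm f a) (abs_le_supNorm g a))

/-! ## §2  The distant part: «(σ_kf′)(p₁) is easily estimated by ‖f^{(k)}‖_∞ by (2.16)» -/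

/-- **The distant part.**  If `f′` vanishes within `r₀` of `p₁` and the row of `p₁` decays beyond `r₀`, `|σ(p₁,p₂)| ≤ ce^{−δ dist(p₁,p₂)}`
((2.16)), then `|(σf′)(p₁)| ≤ c·(Σ_{p₂} e^{−δ dist(p₁,p₂)})·‖f′‖_∞` — the large near-diagonal entries of `σ_k` («of the order of η^{−2}»)
never meet the support of `f′`. [cite: BalabanImbrieJaffe1988, (2.17) p.262] -/
theorem abs_applyK_far_le {dist : α → α → ℝ} {σ : α → α → ℝ} {c δ r₀ : ℝ} (hc : 0 ≤ c) {f' : α → ℝ} {p₁ : α}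
    (h216 : ∀ p₂, r₀ ≤ dist p₁ p₂ → |σ p₁ p₂| ≤ c * Real.exp (-δ * dist p₁ p₂))
    (hfar : ∀ p₂, dist p₁ p₂ < r₀ → f' p₂ = 0) :
    |applyK σ f' p₁| ≤ c * (∑ p₂, Real.exp (-δ * dist p₁ p₂)) * supNorm f' := by
  have hsN := supNorm_nonneg f'
  have hterm : ∀ p₂, |σ p₁ p₂ * f' p₂| ≤ c * Real.exp (-δ * dist p₁ p₂) * supNorm f' := by
    intro p₂
    by_cases h : dist p₁ p₂ < r₀
    · rw [hfar p₂ h, mul_zero, abs_zero]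
      positivity
    · rw [abs_mul]
      exact mul_le_mul (h216 p₂ (not_lt.1 h)) (abs_le_supNorm f' p₂) (abs_nonneg _) (by positivity)
  calc |applyK σ f' p₁| = |∑ p₂, σ p₁ p₂ * f' p₂| := rfl
    _ ≤ ∑ p₂, |σ p₁ p₂ * f' p₂| := abs_sum_le_sum_abs _ _
    _ ≤ ∑ p₂, c * Real.exp (-δ * dist p₁ p₂) * supNorm f' := sum_le_sum fun p₂ _ => hterm p₂
    _ = c * (∑ p₂, Real.exp (-δ * dist p₁ p₂)) * supNorm f' := by rw [mul_sum, sum_mul]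

/-- The distant part from r18's one-letter (2.16), `DecayFar dist σ c` (threshold `c`, rate `c`, constant `c`).
[cite: BalabanImbrieJaffe1988, (2.17) p.262] -/
theorem abs_applyK_far_le_of_decayFar {dist : α → α → ℝ} {σ : α → α → ℝ} {c : ℝ} (hc : 0 ≤ c) (h216 : DecayFar dist σ c)
    {f' : α → ℝ} {p₁ : α} (hfar : ∀ p₂, dist p₁ p₂ < c → f' p₂ = 0) :
    |applyK σ f' p₁| ≤ c * (∑ p₂, Real.exp (-c * dist p₁ p₂)) * supNorm f' :=
  abs_applyK_far_le hc (fun p₂ hp => h216 p₁ p₂ hp) hfar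

/-! ## §3  The near part in the `ℓ²` reading of «σ_k is a bounded operator on curls» -/

/-- A coordinate is at most the `ℓ²` norm: `|v(p₁)| ≤ (Σ_p v(p)²)^{1/2}`. [cite: BalabanImbrieJaffe1988, (2.17) p.262] -/
theorem abs_le_sqrt_sum_sq (v : α → ℝ) (p₁ : α) : |v p₁| ≤ Real.sqrt (∑ p, v p ^ 2) := by
  rw [← Real.sqrt_sq_eq_abs]
  exact Real.sqrt_le_sqrt (single_le_sum (f := fun p => v p ^ 2) (fun p _ => sq_nonneg (v p)) (mem_univ p₁))

/-- `‖g‖₂² ≤ (#s)·‖g‖_∞²` for `g` supported in the finite set `s` (the near part `∂□A` lives on the plaquettes meeting the neighbourhood `□`).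
[cite: BalabanImbrieJaffe1988, (2.17) p.262] -/
theorem sum_sq_le_card_mul_supNorm_sq {g : α → ℝ} {s : Finset α} (hs : ∀ p ∉ s, g p = 0) :
    ∑ p, g p ^ 2 ≤ s.card * supNorm g ^ 2 := by
  have h1 : ∑ p ∈ s, g p ^ 2 = ∑ p, g p ^ 2 :=
    sum_subset (subset_univ s) fun p _ hp => by rw [hs p hp]; ring
  rw [← h1]
  calc ∑ p ∈ s, g p ^ 2 ≤ ∑ p ∈ s, supNorm g ^ 2 := sum_le_sum fun p _ => by
          rw [← sq_abs]
          exact pow_le_pow_left₀ (abs_nonneg _) (abs_le_supNorm g p) 2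
    _ = s.card * supNorm g ^ 2 := by rw [sum_const, nsmul_eq_mul]

/-- **The near part, `ℓ²` reading.**  If `‖σg‖₂ ≤ M‖g‖₂` and `g` is supported in `s`, then `|(σg)(p₁)| ≤ M·(#s)^{1/2}·‖g‖_∞`.
[cite: BalabanImbrieJaffe1988, (2.17) p.262] -/
theorem abs_applyK_near_le_l2 {σ : α → α → ℝ} {g : α → ℝ} {M : ℝ} (hM : 0 ≤ M) {s : Finset α}
    (hl2 : ∑ p, applyK σ g p ^ 2 ≤ M ^ 2 * ∑ p, g p ^ 2) (hs : ∀ p ∉ s, g p = 0) (p₁ : α) :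
    |applyK σ g p₁| ≤ M * Real.sqrt s.card * supNorm g := by
  have h1 := abs_le_sqrt_sum_sq (applyK σ g) p₁
  have h2 : Real.sqrt (∑ p, applyK σ g p ^ 2) ≤ Real.sqrt (M ^ 2 * ((s.card : ℝ) * supNorm g ^ 2)) :=
    Real.sqrt_le_sqrt (hl2.trans (mul_le_mul_of_nonneg_left (sum_sq_le_card_mul_supNorm_sq hs) (sq_nonneg M)))
  have h3 : Real.sqrt (M ^ 2 * ((s.card : ℝ) * supNorm g ^ 2)) = M * Real.sqrt s.card * supNorm g := by
    rw [Real.sqrt_mul (sq_nonneg M), Real.sqrt_sq hM, Real.sqrt_mul (Nat.cast_nonneg _), Real.sqrt_sq (supNorm_nonneg g),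
      mul_assoc]
  exact (h1.trans h2).trans_eq h3

/-! ## §4  The split `f^{(k)} = ∂□A + f′` -/

/-- **The split.**  For any near part `g` agreeing with `f` within `r₀` of `p₁` (so that `f′ = f − g` vanishes there), a near bound
`|(σg)(p₁)| ≤ N` and the distant decay (2.16) with row sum `≤ S` give `|(σf)(p₁)| ≤ N + cS(‖f‖_∞ + ‖g‖_∞)`.
[cite: BalabanImbrieJaffe1988, (2.17) p.262] -/
theorem abs_applyK_split_le {dist : α → α → ℝ} {σ : α → α → ℝ} {c δ r₀ N S : ℝ} (hc : 0 ≤ c) {f g : α → ℝ} {p₁ : α}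
    (h216 : ∀ p₂, r₀ ≤ dist p₁ p₂ → |σ p₁ p₂| ≤ c * Real.exp (-δ * dist p₁ p₂))
    (hS : ∑ p₂, Real.exp (-δ * dist p₁ p₂) ≤ S) (hnear : |applyK σ g p₁| ≤ N)
    (hagree : ∀ p₂, dist p₁ p₂ < r₀ → f p₂ = g p₂) :
    |applyK σ f p₁| ≤ N + c * S * (supNorm f + supNorm g) := by
  have hsplit : applyK σ f p₁ = applyK σ g p₁ + applyK σ (fun a => f a - g a) p₁ := by
    rw [applyK_sub]; ring
  have hfar : |applyK σ (fun a => f a - g a) p₁| ≤ c * (∑ p₂, Real.exp (-δ * dist p₁ p₂)) * supNorm (fun a => f a - g a) :=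
    abs_applyK_far_le hc h216 fun p₂ hp => by simp [hagree p₂ hp]
  have hsum : 0 ≤ ∑ p₂, Real.exp (-δ * dist p₁ p₂) := sum_nonneg fun _ _ => (Real.exp_pos _).le
  have hsN : 0 ≤ supNorm (fun a => f a - g a) := supNorm_nonneg _
  calc |applyK σ f p₁| ≤ |applyK σ g p₁| + |applyK σ (fun a => f a - g a) p₁| := by
          rw [hsplit]; exact abs_add_le _ _
    _ ≤ N + c * (∑ p₂, Real.exp (-δ * dist p₁ p₂)) * supNorm (fun a => f a - g a) := add_le_add hnear hfar
    _ ≤ N + c * S * (supNorm f + supNorm g) := by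
          refine add_le_add le_rfl (mul_le_mul (mul_le_mul_of_nonneg_left hS hc) (supNorm_sub_le f g) hsN ?_)
          exact mul_nonneg hc (hsum.trans hS)

/-! ## §5  (2.17) with its constant -/

/-- The row sum dominates a positive term, so `0 ≤ S`. [cite: BalabanImbrieJaffe1988, (2.16) p.261] -/
theorem rowSum_nonneg {dist : α → α → ℝ} {δ S : ℝ} {p₁ : α} (hS : ∑ p₂, Real.exp (-δ * dist p₁ p₂) ≤ S) : 0 ≤ S :=
  (sum_nonneg fun _ _ => (Real.exp_pos _).le).trans hS

/-- **(2.17), sup-norm reading of «σ_k is a bounded operator on curls», explicit constant.**  With (2.16) beyond `r₀` at `p₁` (row sum `≤ S`),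
`|(σg)(p₁)| ≤ M‖g‖_∞` for `g` in the class `V` of curls, and a near part `g ∈ V` agreeing with `f` within `r₀` of `p₁`, `‖g‖_∞ ≤ K‖f‖_∞`:
`|(σ_kf)(p₁)| ≤ (MK + cS(1+K))·‖f‖_∞`. [cite: BalabanImbrieJaffe1988, (2.17) p.262] -/
theorem abs_ineq217 {dist : α → α → ℝ} {σ : α → α → ℝ} {c δ r₀ M K S : ℝ} (hc : 0 ≤ c) (hM : 0 ≤ M) {V : Set (α → ℝ)}
    {f g : α → ℝ} {p₁ : α} (h216 : ∀ p₂, r₀ ≤ dist p₁ p₂ → |σ p₁ p₂| ≤ c * Real.exp (-δ * dist p₁ p₂))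
    (hS : ∑ p₂, Real.exp (-δ * dist p₁ p₂) ≤ S) (hV : ∀ g ∈ V, |applyK σ g p₁| ≤ M * supNorm g) (hg : g ∈ V)
    (hagree : ∀ p₂, dist p₁ p₂ < r₀ → f p₂ = g p₂) (hgK : supNorm g ≤ K * supNorm f) :
    |applyK σ f p₁| ≤ (M * K + c * S * (1 + K)) * supNorm f := by
  have h := abs_applyK_split_le hc h216 hS (hV g hg) hagree
  have hS0 : 0 ≤ S := rowSum_nonneg hS
  have h1 : M * supNorm g ≤ M * (K * supNorm f) := mul_le_mul_of_nonneg_left hgK hM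
  have h2 : c * S * (supNorm f + supNorm g) ≤ c * S * (supNorm f + K * supNorm f) :=
    mul_le_mul_of_nonneg_left (add_le_add le_rfl hgK) (mul_nonneg hc hS0)
  calc |applyK σ f p₁| ≤ M * supNorm g + c * S * (supNorm f + supNorm g) := h
    _ ≤ M * (K * supNorm f) + c * S * (supNorm f + K * supNorm f) := add_le_add h1 h2
    _ = (M * K + c * S * (1 + K)) * supNorm f := by ring

/-- **(2.17), `ℓ²` reading, explicit constant.**  With `‖σg‖₂ ≤ M‖g‖₂` on the class `V`, the near part `g ∈ V` supported on `≤ n`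
plaquettes: `|(σ_kf)(p₁)| ≤ (M√n·K + cS(1+K))·‖f‖_∞`. [cite: BalabanImbrieJaffe1988, (2.17) p.262] -/
theorem abs_ineq217_l2 {dist : α → α → ℝ} {σ : α → α → ℝ} {c δ r₀ M K S : ℝ} {n : ℕ} (hc : 0 ≤ c) (hM : 0 ≤ M)
    {V : Set (α → ℝ)} {f g : α → ℝ} {p₁ : α} {s : Finset α}
    (h216 : ∀ p₂, r₀ ≤ dist p₁ p₂ → |σ p₁ p₂| ≤ c * Real.exp (-δ * dist p₁ p₂))
    (hS : ∑ p₂, Real.exp (-δ * dist p₁ p₂) ≤ S) (hV2 : ∀ g ∈ V, ∑ p, applyK σ g p ^ 2 ≤ M ^ 2 * ∑ p, g p ^ 2) (hg : g ∈ V)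
    (hs : ∀ p ∉ s, g p = 0) (hn : s.card ≤ n) (hagree : ∀ p₂, dist p₁ p₂ < r₀ → f p₂ = g p₂)
    (hgK : supNorm g ≤ K * supNorm f) :
    |applyK σ f p₁| ≤ (M * Real.sqrt n * K + c * S * (1 + K)) * supNorm f := by
  have hnear := abs_applyK_near_le_l2 hM (hV2 g hg) hs p₁
  have h := abs_applyK_split_le hc h216 hS hnear hagree
  have hS0 : 0 ≤ S := rowSum_nonneg hS
  have hsn : Real.sqrt s.card ≤ Real.sqrt n := Real.sqrt_le_sqrt (by exact_mod_cast hn)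
  have h1 : M * Real.sqrt s.card * supNorm g ≤ M * Real.sqrt n * (K * supNorm f) :=
    (mul_le_mul_of_nonneg_right (mul_le_mul_of_nonneg_left hsn hM) (supNorm_nonneg g)).trans
      (mul_le_mul_of_nonneg_left hgK (mul_nonneg hM (Real.sqrt_nonneg _)))
  have h2 : c * S * (supNorm f + supNorm g) ≤ c * S * (supNorm f + K * supNorm f) :=
    mul_le_mul_of_nonneg_left (add_le_add le_rfl hgK) (mul_nonneg hc hS0)
  calc |applyK σ f p₁| ≤ M * Real.sqrt s.card * supNorm g + c * S * (supNorm f + supNorm g) := h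
    _ ≤ M * Real.sqrt n * (K * supNorm f) + c * S * (supNorm f + K * supNorm f) := add_le_add h1 h2
    _ = (M * Real.sqrt n * K + c * S * (1 + K)) * supNorm f := by ring

/-- **(2.17) as displayed** (one-sided), sup reading: `(σ_kf^{(k)})(p₁) ≤ (MK + cS(1+K))‖f^{(k)}‖_∞`. [cite: BalabanImbrieJaffe1988, (2.17) p.262] -/
theorem ineq217 {dist : α → α → ℝ} {σ : α → α → ℝ} {c δ r₀ M K S : ℝ} (hc : 0 ≤ c) (hM : 0 ≤ M) {V : Set (α → ℝ)}
    {f g : α → ℝ} {p₁ : α} (h216 : ∀ p₂, r₀ ≤ dist p₁ p₂ → |σ p₁ p₂| ≤ c * Real.exp (-δ * dist p₁ p₂))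
    (hS : ∑ p₂, Real.exp (-δ * dist p₁ p₂) ≤ S) (hV : ∀ g ∈ V, |applyK σ g p₁| ≤ M * supNorm g) (hg : g ∈ V)
    (hagree : ∀ p₂, dist p₁ p₂ < r₀ → f p₂ = g p₂) (hgK : supNorm g ≤ K * supNorm f) :
    applyK σ f p₁ ≤ (M * K + c * S * (1 + K)) * supNorm f :=
  (le_abs_self _).trans (abs_ineq217 hc hM h216 hS hV hg hagree hgK)

/-! ## §6  The typed row `BIJ88Sect2Statements.Ineq217` -/

/-- **THE TYPED ROW** `Ineq217 σ Near` (print's display, constant 1) with the side condition of p. 262 made explicit —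
`Near p₁ f` := «within `r₀` of `p₁`, `f` agrees with some `g` in the class `V` of curls with `‖g‖_∞ ≤ K‖f‖_∞`» (the printed `f^{(k)} = ∂A` near
`p₁`, `g = ∂□A`) — is inhabited as soon as the explicit constant satisfies `MK + cS(1+K) ≤ 1`, given (2.16) beyond `r₀` with rate `δ`, row sums
`≤ S`, and the sup-norm boundedness of `σ` on `V`. [cite: BalabanImbrieJaffe1988, (2.17) p.262] -/
theorem ineq217_typed {dist : α → α → ℝ} {σ : α → α → ℝ} {c δ r₀ M K S : ℝ} (hc : 0 ≤ c) (hM : 0 ≤ M) (V : Set (α → ℝ))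
    (h216 : ∀ p₁ p₂, r₀ ≤ dist p₁ p₂ → |σ p₁ p₂| ≤ c * Real.exp (-δ * dist p₁ p₂))
    (hS : ∀ p₁, ∑ p₂, Real.exp (-δ * dist p₁ p₂) ≤ S) (hV : ∀ g ∈ V, ∀ p, |applyK σ g p| ≤ M * supNorm g)
    (hsmall : M * K + c * S * (1 + K) ≤ 1) :
    Ineq217 σ (fun p₁ f => ∃ g ∈ V, (∀ p₂, dist p₁ p₂ < r₀ → f p₂ = g p₂) ∧ supNorm g ≤ K * supNorm f) := by
  intro f p₁ hf
  obtain ⟨g, hg, hagree, hgK⟩ := hf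
  have h := ineq217 hc hM (h216 p₁) (hS p₁) (fun g hg => hV g hg p₁) hg hagree hgK
  exact h.trans ((mul_le_mul_of_nonneg_right hsmall (supNorm_nonneg f)).trans_eq (one_mul _))

/-- The typed row from r18's one-letter (2.16), `DecayFar dist σ c` (so `r₀ = δ = c`). [cite: BalabanImbrieJaffe1988, (2.17) p.262] -/
theorem ineq217_typed_of_decayFar {dist : α → α → ℝ} {σ : α → α → ℝ} {c M K S : ℝ} (hc : 0 ≤ c) (hM : 0 ≤ M) (V : Set (α → ℝ))
    (h216 : DecayFar dist σ c) (hS : ∀ p₁, ∑ p₂, Real.exp (-c * dist p₁ p₂) ≤ S)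
    (hV : ∀ g ∈ V, ∀ p, |applyK σ g p| ≤ M * supNorm g) (hsmall : M * K + c * S * (1 + K) ≤ 1) :
    Ineq217 σ (fun p₁ f => ∃ g ∈ V, (∀ p₂, dist p₁ p₂ < c → f p₂ = g p₂) ∧ supNorm g ≤ K * supNorm f) :=
  ineq217_typed hc hM V (fun p₁ p₂ hp => h216 p₁ p₂ hp) hS hV hsmall

end

end Literature.MathematicalPhysics.QuantumFieldTheory.BalabanImbrieJaffe1984to88.BIJ88Ineq217Mechanism
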